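import Mathlib
import Summits.ValiantsHypothesis.ValiantsHypothesis.Theses.RefutationDegree
import Literature.Computability.AlgebraicComplexity.DeterminantalConormalBoundKernelAlgebra

/-!
# RefutationDegree — `SosSound` (item stmt-ValiantsHypothesis-5645)

Soundness of Hermitian sums-of-squares refutations of the system Rep(n,m)
("`per_n = det (A₀ + Σ_e x_e A_e)` identically in `x`", unknowns = the entries of the `A`'s):
if such a refutation exists (of any degree) then `per_n` has no affine determinantal
representation of size `m`.

Proof (folklore; Grigoriev 2001 §1 for the shape of the certificates): a representation
`per_n = det A` with affine entries `A i j = a₀ᵢⱼ + Σ_e aₑᵢⱼ x_e` gives a point `a` of the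
unknowns at which every equation `coeff_μ (det A(x) − per_n) = 0` holds; evaluating the identity
`Σ qᵢ qᵢ* + Σ (h_μ eq_μ + (h_μ eq_μ)*) + 1 = 0` under `x ↦ a` on the holomorphic copy and
`x ↦ conj a` on the anti-holomorphic copy (so that `*` becomes complex conjugation) yields
`Σ |qᵢ(a, ā)|² + 0 + 1 = 0` in `ℂ`, which is absurd.

The degree bound `d` plays no role.
-/

-- `Summit.ValiantsHypothesis.ValiantsHypothesis.…` is the tree's mandated single-conjunct layout
-- (Sub = Summit), so the duplicated namespace component is intended.
set_option linter.dupNamespace false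

namespace Summit.ValiantsHypothesis.ValiantsHypothesis.Theorems

namespace RefutationDegreeSosSound

open MvPolynomial

/-- Evaluating at `(a, conj ∘ a)` intertwines the formal conjugation
`p ↦ rename Sum.swap (map conj p)` on `MvPolynomial (V ⊕ V) ℂ` with complex conjugation. -/
theorem eval_rename_swap_map_conj {V : Type*} (a : V → ℂ) (p : MvPolynomial (V ⊕ V) ℂ) :
    eval (Sum.elim a (starRingEnd ℂ ∘ a)) (rename Sum.swap (MvPolynomial.map (starRingEnd ℂ) p)) =
      starRingEnd ℂ (eval (Sum.elim a (starRingEnd ℂ ∘ a)) p) := by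
  rw [eval_rename, eval_map, eval₂_comp]
  congr 1
  funext v
  rcases v with v | v <;> simp

/-- Evaluating a polynomial in the first copy of the variables at `Sum.elim a b` is evaluating
it at `a`. -/
theorem eval_sum_elim_rename_inl {V R : Type*} [CommSemiring R] (a b : V → R)
    (r : MvPolynomial V R) : eval (Sum.elim a b) (rename Sum.inl r) = eval a r := by
  rw [eval_rename, Sum.elim_comp_inl]

/-- **Hermitian SOS certificates are sound.** If the equations `g μ` (`μ ∈ s`) have a common
complex zero `a`, then no identity `Σᵢ qᵢ qᵢ* + Σ_{μ ∈ s} (h_μ g_μ + (h_μ g_μ)*) + 1 = 0` can hold in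
`MvPolynomial (V ⊕ V) ℂ` (`*` = conjugate the coefficients and swap the two copies of the
variables): evaluating at `(a, ā)` gives `Σ |qᵢ(a,ā)|² + 1 = 0`. -/
theorem false_of_hermitian_sos_certificate {V ι : Type*} (a : V → ℂ) (s : Finset ι)
    (g : ι → MvPolynomial V ℂ) (hg : ∀ μ ∈ s, eval a (g μ) = 0) {k : ℕ}
    (q : Fin k → MvPolynomial (V ⊕ V) ℂ) (h : ι → MvPolynomial (V ⊕ V) ℂ)
    (hsum : ∑ i, q i * rename Sum.swap (MvPolynomial.map (starRingEnd ℂ) (q i)) +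
        ∑ μ ∈ s, (h μ * rename Sum.inl (g μ) +
          rename Sum.swap (MvPolynomial.map (starRingEnd ℂ) (h μ * rename Sum.inl (g μ)))) + 1 = 0) :
    False := by
  have key := congrArg (eval (Sum.elim a (starRingEnd ℂ ∘ a))) hsum
  simp only [map_add, map_sum, map_mul, map_one, map_zero, eval_rename_swap_map_conj,
    eval_sum_elim_rename_inl] at key
  have h2 : ∑ μ ∈ s, (eval (Sum.elim a (starRingEnd ℂ ∘ a)) (h μ) * eval a (g μ) +
      starRingEnd ℂ (eval (Sum.elim a (starRingEnd ℂ ∘ a)) (h μ)) * starRingEnd ℂ (eval a (g μ))) =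
      0 :=
    Finset.sum_eq_zero fun μ hμ => by simp [hg μ hμ]
  rw [h2, add_zero] at key
  simp only [Complex.mul_conj] at key
  have hre : ∑ i, Complex.normSq (eval (Sum.elim a (starRingEnd ℂ ∘ a)) (q i)) + 1 = 0 := by
    exact_mod_cast key
  have hpos : 0 ≤ ∑ i, Complex.normSq (eval (Sum.elim a (starRingEnd ℂ ∘ a)) (q i)) :=
    Finset.sum_nonneg fun i _ => Complex.normSq_nonneg _
  linarith

/-- Base change of the generic affine pencil `(X₀ᵢⱼ + Σ_e x_e Xₑᵢⱼ)ᵢⱼ` along the evaluation of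
the unknowns `X` at a point `a`: the result is the concrete affine matrix
`(a₀ᵢⱼ + Σ_e aₑᵢⱼ x_e)ᵢⱼ`. -/
theorem mapMatrix_eval_pencil {σ R : Type*} [CommSemiring R] [Fintype σ] {m : ℕ}
    (a : Option σ × (Fin m × Fin m) → R) :
    (MvPolynomial.map (eval a)).mapMatrix
        (Matrix.of fun i j : Fin m =>
          C (X (none, (i, j))) + ∑ e : σ, X e * C (X (some e, (i, j))) :
          Matrix (Fin m) (Fin m) (MvPolynomial σ (MvPolynomial (Option σ × (Fin m × Fin m)) R))) =
      Matrix.of fun i j : Fin m => C (a (none, (i, j))) + ∑ e : σ, C (a (some e, (i, j))) * X e := by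
  refine Matrix.ext fun i j => ?_
  simp only [RingHom.mapMatrix_apply, Matrix.map_apply, Matrix.of_apply, map_add, map_sum, map_mul,
    map_C, map_X, eval_X]
  exact congrArg _ (Finset.sum_congr rfl fun e _ => mul_comm _ _)

/-- Affine normal form: a matrix `A` of affine entries is the pencil evaluated at the point
`a` collecting the constant and linear coefficients of its entries. -/
theorem pencil_at_coeffs_eq {σ R : Type*} [CommSemiring R] [Fintype σ] {m : ℕ}
    (A : Matrix (Fin m) (Fin m) (MvPolynomial σ R)) (hA : ∀ i j, (A i j).totalDegree ≤ 1)
    (a : Option σ × (Fin m × Fin m) → R) (ha0 : ∀ i j, a (none, (i, j)) = coeff 0 (A i j))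
    (ha1 : ∀ e i j, a (some e, (i, j)) = coeff (Finsupp.single e 1) (A i j)) :
    (Matrix.of fun i j : Fin m => C (a (none, (i, j))) + ∑ e : σ, C (a (some e, (i, j))) * X e) =
      A := by
  refine Matrix.ext fun i j => ?_
  rw [Matrix.of_apply]
  conv_rhs =>
    rw [Literature.Computability.AlgebraicComplexity.DeterminantalConormal.eq_C_add_sum_of_totalDegree_le_one
      (hA i j)]
  simp only [ha0, ha1]

/-- At the coefficient point `a` of an affine determinantal representation `det A = f`, every
equation of the system Rep — the `x`-coefficients of the defect `det (pencil) − f` — vanishes. -/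
theorem eval_coeff_defect_eq_zero {σ R : Type*} [CommRing R] [Fintype σ] {m : ℕ}
    {f : MvPolynomial σ R} (A : Matrix (Fin m) (Fin m) (MvPolynomial σ R))
    (hA : ∀ i j, (A i j).totalDegree ≤ 1) (hdet : A.det = f)
    (a : Option σ × (Fin m × Fin m) → R) (ha0 : ∀ i j, a (none, (i, j)) = coeff 0 (A i j))
    (ha1 : ∀ e i j, a (some e, (i, j)) = coeff (Finsupp.single e 1) (A i j)) (μ : σ →₀ ℕ) :
    eval a (coeff μ ((Matrix.of fun i j : Fin m =>
          C (X (none, (i, j))) + ∑ e : σ, X e * C (X (some e, (i, j))) :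
          Matrix (Fin m) (Fin m) (MvPolynomial σ (MvPolynomial (Option σ × (Fin m × Fin m)) R))).det
        - MvPolynomial.map C f)) = 0 := by
  rw [← coeff_map, map_sub, RingHom.map_det, mapMatrix_eval_pencil, pencil_at_coeffs_eq A hA a ha0 ha1,
    hdet, map_map]
  have hid : (eval a).comp (C : R →+* MvPolynomial (Option σ × (Fin m × Fin m)) R) = RingHom.id R := by
    ext r
    simp
  rw [hid, map_id, sub_self, coeff_zero]

end RefutationDegreeSosSound

open MvPolynomial in
/-- **SosSound** (item stmt-ValiantsHypothesis-5645 of route RefutationDegree): a Hermitian-SOS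
refutation of Rep(n,m), of any degree, excludes an affine determinantal representation of
`per_n` of size `m` — evaluate the certificate at `(a, ā)` for the coefficient point `a` of a
putative representation and read off `Σ |qᵢ|² + 1 = 0`. -/
theorem sosSound_proof :
    Summit.ValiantsHypothesis.ValiantsHypothesis.Theses.RefutationDegree.SosSound := by
  unfold Summit.ValiantsHypothesis.ValiantsHypothesis.Theses.RefutationDegree.SosSound
  intro n m d hcert hrepr
  obtain ⟨A, hA, hdet⟩ := hrepr
  obtain ⟨k, q, h, -, -, hsum⟩ := hcert
  exact RefutationDegreeSosSound.false_of_hermitian_sos_certificate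
    (fun v : Option (Fin n × Fin n) × (Fin m × Fin m) =>
      v.1.elim (coeff 0 (A v.2.1 v.2.2)) fun e => coeff (Finsupp.single e 1) (A v.2.1 v.2.2))
    _ _
    (fun μ _ => RefutationDegreeSosSound.eval_coeff_defect_eq_zero A hA hdet _
      (fun _ _ => rfl) (fun _ _ _ => rfl) μ)
    q h hsum

end Summit.ValiantsHypothesis.ValiantsHypothesis.Theorems
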